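import Literature.Barriers.CriticalPhenomena.WeaklySAWSusceptibilityLowerBound
import Literature.Probability.RandomPlanarGeometry.SAWBubbleBound
import Mathlib.MeasureTheory.Group.Measure
import HarnessLib

/-!
# The continuous-time weakly self-avoiding walk: sub-multiplicativity `c_{T+S} ≤ c_T c_S`
# and the critical value (`χ(g,ν) < ∞ ↔ ν > ν_c`)

Support file for the discharge of `Literature.Barriers.CriticalPhenomena.CTWSAW.BBS2015_lemA1`
(Bauerschmidt–Brydges–Slade 2015, Lemma A.1) in the jump-chain representation of
`WeaklySAWFourDimLogCorrections.lean`.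

The printed proof: "`I(T) = I(0,T) ≥ I(0,S) + I(S,T)` … By the Markov property, `I(0,T)` and
`I(T,T+S)` are conditionally independent given `X(T)`. Using translation-invariance, it therefore
follows that `c_{T+S} ≤ E(e^{-gI(0,T)} e^{-gI(T,T+S)}) = c_T c_S`. A standard lemma for subadditive
functions now yields the existence of a critical value `ν_c` … such that `c_T^{1/T} → e^{ν_c}` and
also `c_T ≥ e^{ν_c T}`" [BBS2015, Appendix A, (A.1)–(A.3)].

In the jump-chain representation (`survival d g T = e^{-2dT} Σ_k Σ_ω ∫_{Δ_k(T)} e^{-gI} ds`) the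
Markov property becomes an explicit change of variables, carried out here:
* walks ↔ vertex functions (`sum_walks_eq_sum_fun`), and the concatenation bijection
  `{(j+l)-step walks} ≅ {j-step walks} × {l-step walks}` on vertex functions (`sum_fun_split`);
* for a `(j+l)`-jump skeleton, the sojourn configurations with exactly `j` jumps before time `T`
  are mapped by a unimodular shear onto `Δ_j(T) × Δ_l(S)` (`measurePreserving_split`,
  `hd_mem_tl_mem`), under which `I(T+S) ≥ I¹(T) + I²(S)` (`isect_split_le`, dropping the cross
  terms), whence `lintegral_piece_le'`; the exceptional configurations (a jump exactly at time `T`)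
  are Lebesgue-null (`volume_partialSum_eq`);
* summing over `j` (cover `pint_le_sum_pieces`), over skeletons, and over `k = j + l` (Cauchy
  product in `ℝ≥0∞`, `SAW.Zd.ennreal_tsum_mul_tsum_eq_tsum_sum_antidiagonal` of `SAWBubbleBound.lean`) gives
  **`survival_add_le : c_{T+S} ≤ c_T c_S`** (`T, S > 0`, `g ≥ 0`).
Consequences (without Fekete's lemma): `survival_le_pow` (`c_T ≤ c_{T₀}ⁿ` for `nT₀ < T`),
`susceptibility_lt_top_of_ratio_lt_one` (`χ(ν) < ∞` once `c_{T₀}e^{-νT₀} < 1`, a geometric series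
over the time blocks `(nT₀,(n+1)T₀]`), `exists_lt_susceptibility_lt_top` (`{ν | χ < ∞}` is open to
the left), hence, with `bddBelow_susceptibility_lt_top` (`WeaklySAWSusceptibilityLowerBound.lean`)
and `susceptibility_lt_top_of_criticalNu_lt` (`…Proofs.lean`),
**`susceptibility_lt_top_iff : χ(g,ν) < ∞ ↔ ν_c < ν`** and
**`susceptibility_criticalNu_eq_top : χ(g,ν_c) = ∞`** (`d ≥ 1`, `g ≥ 0`).

## References
* R. Bauerschmidt, D. C. Brydges, G. Slade, CMP 337 (2015), Appendix A, Lemma A.1, (A.1)–(A.3).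
  [BauerschmidtBrydgesSlade2015LogCorr]
* N. Madras, G. Slade, *The Self-Avoiding Walk* (1993), Lemma 1.2.2 (the subadditive lemma the
  source cites as [MS93]).
-/

noncomputable section

open MeasureTheory Set Filter Literature.Probability.LatticeModels Literature.Probability.Percolation
open Literature.Probability.RandomPlanarGeometry.SAW.Zd (walkOfFn getVert_walkOfFn length_walkOfFn
  mem_box_of_walk zdGraph_adj_sub_right zdGraph_adj_add_right)
open scoped ENNReal BigOperators Nat

namespace Literature.Barriers.CriticalPhenomena.CTWSAW

variable {d : ℕ}

/-! ### The intersection functional of a vertex function -/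

/-- `I(T, k, v, s) = Σ_{i,i' ≤ k} 𝟙{v i = v i'} σ_i σ_{i'}`, `σ = sojourns T s`: the self-intersection
local time of the trajectory with vertex function `v : ℕ → ℤ^d`, `k` jumps and durations `s`. -/
local notation3 (prettyPrint := false) "Isect[" T ", " k ", " v ", " s "]" =>
  ∑ i : Fin (k + 1), ∑ i' : Fin (k + 1),
    (if v (i : ℕ) = v (i' : ℕ) then sojourns T s i * sojourns T s i' else (0 : ℝ))

/-- `P(g, T, k, v) = ∫_{Δ_k(T)} e^{-g I(T,k,v,s)} ds`. -/
local notation3 (prettyPrint := false) "Pint[" g ", " T ", " k ", " v "]" =>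
  ∫⁻ s in sojournSet k T, ENNReal.ofReal (Real.exp (-g * Isect[T, k, v, s]))

/-- The self-intersection local time of a walk is that of its vertex function. [folklore] -/
theorem selfIntersection_eq_isect (T : ℝ) {x : Site d} (ω : (zdGraph d).Walk 0 x)
    (s : Fin ω.length → ℝ) :
    selfIntersection T ω s = Isect[T, ω.length, (fun m => ω.getVert m), s] := by
  unfold selfIntersection
  rfl

/-- The path integral of a walk is that of its vertex function. [folklore] -/
theorem pathIntegral_eq_pint (g T : ℝ) {x : Site d} (ω : (zdGraph d).Walk 0 x) :
    pathIntegral g T ω = Pint[g, T, ω.length, (fun m => ω.getVert m)] := by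
  unfold pathIntegral
  simp_rw [selfIntersection_eq_isect]

/-- `I(T,k,v,s)` only depends on the coincidence pattern of `v` on `[0, k]`. [folklore] -/
theorem isect_congr {k : ℕ} {v w : ℕ → Site d} (h : ∀ m ≤ k, ∀ m' ≤ k, (v m = v m' ↔ w m = w m'))
    (T : ℝ) (s : Fin k → ℝ) : Isect[T, k, v, s] = Isect[T, k, w, s] := by
  refine Finset.sum_congr rfl fun i _ => Finset.sum_congr rfl fun i' _ => ?_
  rw [if_congr (h i (Nat.lt_succ_iff.1 i.isLt) i' (Nat.lt_succ_iff.1 i'.isLt)) rfl rfl]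

/-- `P(g,T,k,v)` only depends on the coincidence pattern of `v` on `[0, k]`. [folklore] -/
theorem pint_congr (g T : ℝ) {k : ℕ} {v w : ℕ → Site d}
    (h : ∀ m ≤ k, ∀ m' ≤ k, (v m = v m' ↔ w m = w m')) : Pint[g, T, k, v] = Pint[g, T, k, w] := by
  refine setLIntegral_congr_fun (measurableSet_sojournSet _ _) fun s _ => ?_
  rw [isect_congr h]

/-- `P(g,T,k,·)` is invariant under translation of the vertex function. [folklore] -/
theorem pint_translate (g T : ℝ) (k : ℕ) (v : ℕ → Site d) (x : Site d) :
    Pint[g, T, k, (fun m => v m - x)] = Pint[g, T, k, v] :=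
  (pint_congr (v := fun m => v m - x) (w := v) g T fun _ _ _ _ => sub_left_inj :)

/-- `I ≥ 0` on the simplex. [folklore] -/
theorem isect_nonneg {k : ℕ} (v : ℕ → Site d) {T : ℝ} {s : Fin k → ℝ} (hs : s ∈ sojournSet k T) :
    0 ≤ Isect[T, k, v, s] :=
  Finset.sum_nonneg fun i _ => Finset.sum_nonneg fun i' _ => by
    split_ifs
    · exact mul_nonneg (sojourns_pos hs i).le (sojourns_pos hs i').le
    · exact le_rfl

/-- The integrand `e^{-gI}` is measurable in `s`. [folklore] -/
@[fun_prop]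
theorem measurable_exp_isect (g T : ℝ) (k : ℕ) (v : ℕ → Site d) :
    Measurable fun s : Fin k → ℝ => ENNReal.ofReal (Real.exp (-g * Isect[T, k, v, s])) := by
  refine Measurable.ennreal_ofReal (Real.measurable_exp.comp (Measurable.const_mul ?_ _))
  refine Finset.measurable_sum _ fun i _ => Finset.measurable_sum _ fun i' _ => ?_
  split_ifs
  · exact (measurable_sojourns T k i).mul (measurable_sojourns T k i')
  · exact measurable_const

/-! ### Walks from the origin as vertex functions -/

/-- The vertex functions `m ↦ ω(m)` (frozen at the endpoint after time `k`) of the `k`-step walks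
of `ℤ^d` from the origin. -/
local notation3 (prettyPrint := false) "AF[" d ", " k "]" =>
  Finset.image (fun p : (Σ x : Site d, (zdGraph d).Walk (0 : Site d) x) => fun m : ℕ => p.2.getVert m)
    ((box d k).sigma fun x => (zdGraph d).finsetWalkLength k (0 : Site d) x)

section VertexFunctions

open scoped Classical

/-- **Vertex functions of `k`-step walks from `0`**: `v 0 = 0`, nearest-neighbour steps up to time
`k`, frozen afterwards. [folklore] -/
theorem mem_AF_iff {k : ℕ} {v : ℕ → Site d} :
    v ∈ AF[d, k] ↔ v 0 = 0 ∧ (∀ i < k, (zdGraph d).Adj (v i) (v (i + 1))) ∧ ∀ i, k ≤ i → v i = v k := by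
  classical
  constructor
  · intro h
    rw [Finset.mem_image] at h
    obtain ⟨⟨x, ω⟩, hp, rfl⟩ := h
    rw [Finset.mem_sigma, SimpleGraph.mem_finsetWalkLength_iff] at hp
    obtain ⟨-, hlen⟩ := hp
    refine ⟨ω.getVert_zero, fun i hi => ω.adj_getVert_succ (hlen ▸ hi), fun i hi => ?_⟩
    simp only
    rw [ω.getVert_of_length_le (hlen ▸ hi), ← hlen, ω.getVert_length]
  · rintro ⟨h0, hadj, hend⟩
    rw [Finset.mem_image]
    refine ⟨⟨v k, (walkOfFn v k hadj).copy h0 rfl⟩, ?_, ?_⟩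
    · rw [Finset.mem_sigma, SimpleGraph.mem_finsetWalkLength_iff]
      refine ⟨mem_box_of_walk ((walkOfFn v k hadj).copy h0 rfl) (by simp), by simp⟩
    · funext m
      simp only [SimpleGraph.Walk.getVert_copy, getVert_walkOfFn]
      rcases le_or_gt m k with hm | hm
      · rw [min_eq_left hm]
      · rw [min_eq_right hm.le, hend m hm.le]

/-- **Walk sums are vertex-function sums**: for a weight depending on the walk through its vertex
function only, `Σ_x Σ_{ω : 0 → x, |ω| = k} F(ω(·)) = Σ_{v} F(v)`. [folklore] -/
theorem sum_walks_eq_sum_fun (k : ℕ) (F : (ℕ → Site d) → ℝ≥0∞) :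
    ∑ x ∈ box d k, ∑ ω ∈ (zdGraph d).finsetWalkLength k (0 : Site d) x, F (fun m => ω.getVert m) =
      ∑ v ∈ AF[d, k], F v := by
  classical
  rw [Finset.sum_image, Finset.sum_sigma]
  rintro ⟨x, ω⟩ hp ⟨y, ω'⟩ hq h
  rw [Finset.mem_coe, Finset.mem_sigma, SimpleGraph.mem_finsetWalkLength_iff] at hp hq
  have hxy : x = y := by
    rw [← ω.getVert_length, ← ω'.getVert_length, hp.2, hq.2]
    exact congrFun h k
  subst hxy
  have : ω = ω' := SimpleGraph.Walk.ext_getVert fun m => congrFun h m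
  subst this
  rfl

/-- The `k`-jump layer of `c_{g,T}` as a vertex-function sum. [folklore] -/
theorem layer_eq_sum_fun (g T : ℝ) (k : ℕ) :
    ∑ x ∈ box d k, ∑ ω ∈ (zdGraph d).finsetWalkLength k (0 : Site d) x, 1 * pathIntegral g T ω =
      ∑ v ∈ AF[d, k], Pint[g, T, k, v] := by
  classical
  rw [← sum_walks_eq_sum_fun k (fun v => Pint[g, T, k, v])]
  refine Finset.sum_congr rfl fun x _ => Finset.sum_congr rfl fun ω hω => ?_
  rw [one_mul, pathIntegral_eq_pint, (SimpleGraph.mem_finsetWalkLength_iff.1 hω)]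

/-- `c_{g,T} = e^{-2dT} Σ_k Σ_{v} P(g,T,k,v)`. [folklore] -/
theorem survival_eq_tsum_sum_fun (d : ℕ) (g T : ℝ) :
    survival d g T = ENNReal.ofReal (Real.exp (-(2 * d) * T)) * ∑' k : ℕ, ∑ v ∈ AF[d, k], Pint[g, T, k, v] := by
  unfold survival weightedExpectation
  congr 1
  exact tsum_congr fun k => layer_eq_sum_fun g T k

/-! ### The concatenation bijection on vertex functions -/

/-- **Splitting a `(j+l)`-step walk after `j` steps** (head `m ↦ v(min m j)`, tail
`m ↦ v(j+m) - v(j)` translated back to the origin) is a bijection onto pairs of a `j`-step and an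
`l`-step walk; hence for a weight `f` reading only `v|[0,j]`,
`Σ_{v : (j+l)-step} f(v) g(tail v) = (Σ_{j-step} f)(Σ_{l-step} g)`. [folklore] -/
theorem sum_fun_split (j l : ℕ) (f g : (ℕ → Site d) → ℝ≥0∞)
    (hf : ∀ v w : ℕ → Site d, (∀ m ≤ j, v m = w m) → f v = f w) :
    ∑ v ∈ AF[d, j + l], f v * g (fun m => v (j + m) - v j) =
      (∑ v ∈ AF[d, j], f v) * ∑ v ∈ AF[d, l], g v := by
  rw [Finset.sum_mul_sum, ← Finset.sum_product']
  refine Finset.sum_nbij' (fun v => ((fun m => v (min m j)), (fun m => v (j + m) - v j)))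
    (fun p => fun m => if m ≤ j then p.1 m else p.1 j + p.2 (m - j)) ?_ ?_ ?_ ?_ ?_
  · -- maps into the product
    intro v hv
    obtain ⟨h0, hadj, hend⟩ := mem_AF_iff.1 hv
    refine Finset.mem_product.2 ⟨mem_AF_iff.2 ⟨?_, ?_, ?_⟩, mem_AF_iff.2 ⟨?_, ?_, ?_⟩⟩
    · show v (min 0 j) = 0
      rw [Nat.zero_min]; exact h0
    · intro i hi
      show (zdGraph d).Adj (v (min i j)) (v (min (i + 1) j))
      rw [min_eq_left hi.le, min_eq_left (by omega)]
      exact hadj i (by omega)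
    · intro i hi
      show v (min i j) = v (min j j)
      rw [min_eq_right hi, min_self]
    · show v (j + 0) - v j = 0
      rw [add_zero, sub_self]
    · intro i hi
      show (zdGraph d).Adj (v (j + i) - v j) (v (j + (i + 1)) - v j)
      rw [zdGraph_adj_sub_right, ← add_assoc]
      exact hadj (j + i) (by omega)
    · intro i hi
      show v (j + i) - v j = v (j + l) - v j
      rw [hend (j + i) (by omega)]
  · -- the inverse maps into `AF (j+l)`
    rintro ⟨v₁, v₂⟩ hp
    obtain ⟨h1, h2⟩ := Finset.mem_product.1 hp
    obtain ⟨h10, h1adj, h1end⟩ := mem_AF_iff.1 h1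
    obtain ⟨h20, h2adj, h2end⟩ := mem_AF_iff.1 h2
    dsimp only at h10 h1adj h1end h20 h2adj h2end
    refine mem_AF_iff.2 ⟨?_, ?_, ?_⟩
    · show (if 0 ≤ j then v₁ 0 else v₁ j + v₂ (0 - j)) = 0
      rw [if_pos (Nat.zero_le j)]; exact h10
    · intro i hi
      show (zdGraph d).Adj (if i ≤ j then v₁ i else v₁ j + v₂ (i - j))
        (if i + 1 ≤ j then v₁ (i + 1) else v₁ j + v₂ (i + 1 - j))
      rcases lt_trichotomy (i + 1) (j + 1) with h | h | h
      · rw [if_pos (by omega), if_pos (by omega)]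
        exact h1adj i (by omega)
      · have hij : i = j := by omega
        subst hij
        rw [if_pos le_rfl, if_neg (by omega), show i + 1 - i = 0 + 1 by omega]
        have h' := h2adj 0 (by omega)
        rw [h20] at h'
        have := (zdGraph_adj_add_right 0 (v₂ (0 + 1)) (v₁ i)).2 h'
        rwa [zero_add, add_comm] at this
      · rw [if_neg (by omega), if_neg (by omega), show i + 1 - j = (i - j) + 1 by omega,
          add_comm (v₁ j), add_comm (v₁ j)]
        exact (zdGraph_adj_add_right _ _ _).2 (h2adj (i - j) (by omega))
    · intro i hi
      show (if i ≤ j then v₁ i else v₁ j + v₂ (i - j)) =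
        (if j + l ≤ j then v₁ (j + l) else v₁ j + v₂ (j + l - j))
      rcases Nat.eq_zero_or_pos l with hl | hl
      · subst hl
        rw [if_pos (le_of_eq (Nat.add_zero j)), Nat.add_zero]
        split_ifs with h
        · exact h1end i (by omega)
        · rw [h2end (i - j) (by omega), h20, add_zero]
      · rw [if_neg (by omega), if_neg (by omega), h2end (i - j) (by omega), Nat.add_sub_cancel_left]
  · -- left inverse
    intro v _
    funext m
    show (if m ≤ j then v (min m j) else v (min j j) + (v (j + (m - j)) - v j)) = v m
    split_ifs with h
    · rw [min_eq_left h]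
    · rw [min_self, show j + (m - j) = m by omega, add_sub_cancel]
  · -- right inverse
    rintro ⟨v₁, v₂⟩ hp
    obtain ⟨h1, h2⟩ := Finset.mem_product.1 hp
    obtain ⟨-, -, h1end⟩ := mem_AF_iff.1 h1
    obtain ⟨h20, -, -⟩ := mem_AF_iff.1 h2
    dsimp only at h1end h20
    refine Prod.ext (funext fun m => ?_) (funext fun m => ?_)
    · show (if min m j ≤ j then v₁ (min m j) else v₁ j + v₂ (min m j - j)) = v₁ m
      rw [if_pos (min_le_right m j)]
      rcases le_or_gt m j with h | h
      · rw [min_eq_left h]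
      · rw [min_eq_right h.le, h1end m h.le]
    · show (if j + m ≤ j then v₁ (j + m) else v₁ j + v₂ (j + m - j)) -
          (if j ≤ j then v₁ j else v₁ j + v₂ (j - j)) = v₂ m
      rw [if_pos (le_refl j)]
      rcases Nat.eq_zero_or_pos m with h | h
      · subst h
        rw [if_pos (le_of_eq (Nat.add_zero j)), Nat.add_zero, sub_self, h20]
      · rw [if_neg (by omega), Nat.add_sub_cancel_left, add_sub_cancel_left]
  · -- the weights agree
    intro v _
    show f v * g _ = f (fun m => v (min m j)) * g _
    rw [hf v (fun m => v (min m j)) fun m hm => by rw [min_eq_left hm]]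

end VertexFunctions

/-! ### Splitting the durations at time `T`: the algebra of `I(T+S) ≥ I¹(T) + I²(S)` -/

section SplitAlgebra

open Finset

/-- Zero-extension to `ℕ` of a vector indexed by `Fin (n+1)`. -/
local notation3 (prettyPrint := false) "ext[" n ", " σ "]" =>
  fun m : ℕ => if h : m < n + 1 then (σ : Fin (n + 1) → ℝ) ⟨m, h⟩ else 0

/-- Evaluating the zero-extension inside the range. [folklore] -/
theorem dite_fin_val {n : ℕ} (σ : Fin (n + 1) → ℝ) (i : Fin (n + 1)) :
    (if h : (i : ℕ) < n + 1 then σ ⟨i, h⟩ else 0) = σ i := by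
  rw [dif_pos i.isLt]

/-- Re-indexing an application of `s : Fin k → ℝ` along an equality of indices. [folklore] -/
theorem apply_mk_congr {k : ℕ} (s : Fin k → ℝ) {m m' : ℕ} (h : m = m') (hm : m < k) (hm' : m' < k) :
    s ⟨m, hm⟩ = s ⟨m', hm'⟩ := by
  subst h; rfl

/-- **`I` as a double sum over `ℕ`** (through the zero-extension of the sojourn vector). [folklore] -/
theorem isect_eq_sum_range (T : ℝ) (k : ℕ) (v : ℕ → Site d) (s : Fin k → ℝ) :
    Isect[T, k, v, s] = ∑ m ∈ range (k + 1), ∑ m' ∈ range (k + 1),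
      (if v m = v m' then ext[k, sojourns T s] m * ext[k, sojourns T s] m' else 0) := by
  rw [← Fin.sum_univ_eq_sum_range (fun m => ∑ m' ∈ range (k + 1),
      (if v m = v m' then ext[k, sojourns T s] m * ext[k, sojourns T s] m' else 0)) (k + 1)]
  refine Finset.sum_congr rfl fun i _ => ?_
  rw [← Fin.sum_univ_eq_sum_range (fun m' =>
      (if v i = v m' then ext[k, sojourns T s] i * ext[k, sojourns T s] m' else 0)) (k + 1)]
  refine Finset.sum_congr rfl fun i' _ => ?_
  simp only [dite_fin_val]

/-- Double range sums of a function supported in `[0,n] × [0,n]` do not see larger ranges. [folklore] -/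
theorem sum_range_sq_subset {N n : ℕ} (hN : n + 1 ≤ N) (F : ℕ → ℕ → ℝ)
    (h1 : ∀ m m', n + 1 ≤ m → F m m' = 0) (h2 : ∀ m m', n + 1 ≤ m' → F m m' = 0) :
    ∑ m ∈ range (n + 1), ∑ m' ∈ range (n + 1), F m m' = ∑ m ∈ range N, ∑ m' ∈ range N, F m m' := by
  have hsub : range (n + 1) ⊆ range N := Finset.range_subset_range.2 hN
  rw [Finset.sum_subset hsub fun m _ hm' => ?_]
  · refine Finset.sum_congr rfl fun m _ => Finset.sum_subset hsub fun m' _ hm' => h2 m m' ?_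
    simpa using hm'
  · exact Finset.sum_eq_zero fun m' _ => h1 m m' (by simpa using hm')

/-- Shifting a double range sum by `j` (the tail block of the split). [folklore] -/
theorem sum_range_sq_shift (j l : ℕ) (v : ℕ → Site d) (b : ℕ → ℝ) :
    ∑ m ∈ range (j + l + 1), ∑ m' ∈ range (j + l + 1),
      (if v m = v m' then (if j ≤ m then b (m - j) else 0) * (if j ≤ m' then b (m' - j) else 0) else 0) =
    ∑ p ∈ range (l + 1), ∑ p' ∈ range (l + 1), (if v (j + p) = v (j + p') then b p * b p' else 0) := by
  rw [show j + l + 1 = j + (l + 1) by ring, Finset.sum_range_add,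
    Finset.sum_eq_zero (fun m hm => ?_), zero_add]
  · refine Finset.sum_congr rfl fun p _ => ?_
    rw [Finset.sum_range_add, Finset.sum_eq_zero (fun m' hm' => ?_), zero_add]
    · refine Finset.sum_congr rfl fun p' _ => ?_
      rw [if_pos (Nat.le_add_right j p), if_pos (Nat.le_add_right j p'), Nat.add_sub_cancel_left,
        Nat.add_sub_cancel_left]
    · rw [Finset.mem_range] at hm'
      rw [if_neg (not_le.2 hm'), mul_zero, ite_self]
  · rw [Finset.mem_range] at hm
    refine Finset.sum_eq_zero fun m' _ => ?_
    rw [if_neg (not_le.2 hm), zero_mul, ite_self]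

variable (j l : ℕ) (T S : ℝ)

/-- The head durations `s|_{[0,j)}` of a split configuration. -/
local notation3 (prettyPrint := false) "hd[" s "]" => fun i : Fin j => (s : Fin (j + l) → ℝ) (Fin.castAdd l i)

/-- The tail durations of a split configuration: `s|_{[j, j+l)}` with the first one sheared by
`Σ_{i<j} s_i - T` (the part of the `j`-th sojourn falling after time `T`). -/
local notation3 (prettyPrint := false) "tl[" s "]" => fun i : Fin l =>
  (s : Fin (j + l) → ℝ) (Fin.natAdd j i) + (if (i : ℕ) = 0 then (∑ i' : Fin j, s (Fin.castAdd l i')) - T else 0)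

/-- Total duration of the tail. [folklore] -/
theorem sum_tl (s : Fin (j + l) → ℝ) :
    ∑ i, (tl[s]) i = ∑ i : Fin l, s (Fin.natAdd j i) +
      (if 0 < l then (∑ i' : Fin j, s (Fin.castAdd l i')) - T else 0) := by
  simp only [Finset.sum_add_distrib]
  congr 1
  rcases Nat.eq_zero_or_pos l with hl | hl
  · subst hl
    simp
  · rw [if_pos hl]
    have : ∀ i : Fin l, ((i : ℕ) = 0) = (⟨0, hl⟩ = i) := fun i => by
      rw [Fin.ext_iff]; exact propext ⟨fun h => h.symm, fun h => h.symm⟩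
    simp_rw [this]
    rw [Finset.sum_ite_eq]
    simp

/-- **The sojourns split**: the zero-extended sojourn vector of the full configuration (total time
`T + S`) is the sum of the head sojourns (total `T`) and the shifted tail sojourns (total `S`):
`σ_m = a_m + b_{m-j}`. [cite: BauerschmidtBrydgesSlade2015LogCorr, Appendix A (proof of Lemma A.1, (A.2))] -/
theorem ext_sojourns_split (s : Fin (j + l) → ℝ) (m : ℕ) :
    (ext[j + l, sojourns (T + S) s]) m =
      (ext[j, sojourns T (hd[s])]) m +
        (if j ≤ m then (ext[l, sojourns S (tl[s])]) (m - j) else 0) := by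
  have hsum := Fin.sum_univ_add s
  have htl := sum_tl j l T s
  rcases lt_trichotomy m j with h | rfl | h
  · -- `m < j`: an inner head sojourn
    rw [if_neg (by omega)]
    simp only [dif_pos (show m < j + l + 1 by omega), dif_pos (show m < j + 1 by omega), add_zero]
    rw [show (⟨m, _⟩ : Fin (j + l + 1)) = Fin.castSucc ⟨m, by omega⟩ from rfl, sojourns_castSucc,
      show (⟨m, _⟩ : Fin (j + 1)) = Fin.castSucc ⟨m, h⟩ from rfl, sojourns_castSucc]
    rfl
  · -- `m = j`: the sojourn straddling time `T`
    rw [if_pos le_rfl, Nat.sub_self]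
    simp only [dif_pos (show m < m + l + 1 by omega), dif_pos (show m < m + 1 by omega),
      dif_pos (show 0 < l + 1 by omega)]
    rw [show (⟨m, _⟩ : Fin (m + 1)) = Fin.last m from rfl, sojourns_last]
    rcases Nat.eq_zero_or_pos l with hl | hl
    · subst hl
      rw [show (⟨0, _⟩ : Fin (0 + 1)) = Fin.last 0 from rfl, sojourns_last, htl, if_neg (lt_irrefl 0),
        show (⟨m, _⟩ : Fin (m + 0 + 1)) = Fin.last (m + 0) from rfl, sojourns_last, hsum]
      simp only [Finset.univ_eq_empty, Finset.sum_empty, add_zero]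
      ring
    · rw [show (⟨0, _⟩ : Fin (l + 1)) = Fin.castSucc ⟨0, hl⟩ from rfl, sojourns_castSucc,
        show (⟨m, _⟩ : Fin (m + l + 1)) = Fin.castSucc ⟨m, by omega⟩ from rfl, sojourns_castSucc]
      simp only [if_pos]
      rw [show (Fin.natAdd m ⟨0, hl⟩ : Fin (m + l)) = ⟨m, by omega⟩ from Fin.ext (by simp)]
      ring
  · -- `j < m`
    rw [if_pos h.le]
    simp only [dif_neg (show ¬(m < j + 1) by omega), zero_add]
    rcases lt_trichotomy m (j + l) with h' | rfl | h'
    · -- an inner tail sojourn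
      simp only [dif_pos (show m < j + l + 1 by omega), dif_pos (show m - j < l + 1 by omega)]
      rw [show (⟨m, _⟩ : Fin (j + l + 1)) = Fin.castSucc ⟨m, h'⟩ from rfl, sojourns_castSucc,
        show (⟨m - j, _⟩ : Fin (l + 1)) = Fin.castSucc ⟨m - j, by omega⟩ from rfl, sojourns_castSucc]
      simp only
      rw [if_neg (by omega), add_zero]
      exact apply_mk_congr s (by simp; omega) _ _
    · -- the terminal sojourn (`l > 0`)
      simp only [dif_pos (show j + l < j + l + 1 by omega), dif_pos (show j + l - j < l + 1 by omega)]
      rw [show (⟨j + l, _⟩ : Fin (j + l + 1)) = Fin.last (j + l) from rfl, sojourns_last,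
        show (⟨j + l - j, _⟩ : Fin (l + 1)) = Fin.last l from Fin.ext (by simp), sojourns_last, htl,
        if_pos (by omega), hsum]
      ring
    · -- beyond the walk
      simp only [dif_neg (show ¬(m < j + l + 1) by omega), dif_neg (show ¬(m - j < l + 1) by omega)]

/-- The zero-extension of a sojourn vector on the simplex is nonnegative. [folklore] -/
theorem ext_sojourns_nonneg {k : ℕ} {U : ℝ} {s : Fin k → ℝ} (hs : s ∈ sojournSet k U) (m : ℕ) :
    0 ≤ (ext[k, sojourns U s]) m := by
  simp only
  split_ifs
  · exact (sojourns_pos hs _).le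
  · exact le_rfl

/-- **Dropping the cross terms: `I(T,j,v,s¹) + I(S,l,v(j+·),s²) ≤ I(T+S,j+l,v,s)`** for the split
`s ↦ (s¹, s²) = (hd s, tl s)` of an admissible configuration ("`I(T) ≥ I(0,S) + I(S,T)`").
[cite: BauerschmidtBrydgesSlade2015LogCorr, Appendix A (proof of Lemma A.1, (A.1)–(A.2))] -/
theorem isect_split_le (v : ℕ → Site d) (s : Fin (j + l) → ℝ) (h1 : (hd[s]) ∈ sojournSet j T)
    (h2 : (tl[s]) ∈ sojournSet l S) :
    Isect[T, j, v, (hd[s])] + Isect[S, l, (fun m => v (j + m)), (tl[s])] ≤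
      Isect[T + S, j + l, v, s] := by
  rw [isect_eq_sum_range T j v, isect_eq_sum_range S l (fun m => v (j + m)),
    isect_eq_sum_range (T + S) (j + l) v s]
  have hc := ext_sojourns_split j l T S s
  have ha0 := ext_sojourns_nonneg h1
  have hb0 := ext_sojourns_nonneg h2
  set a := ext[j, sojourns T (hd[s])] with ha
  set b := ext[l, sojourns S (tl[s])] with hb
  set c := ext[j + l, sojourns (T + S) s] with hcdef
  have haz : ∀ m, j + 1 ≤ m → a m = 0 := fun m hm => by rw [ha]; exact dif_neg (by omega)
  -- the head block on the big range
  have hA : ∑ m ∈ range (j + 1), ∑ m' ∈ range (j + 1), (if v m = v m' then a m * a m' else 0) =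
      ∑ m ∈ range (j + l + 1), ∑ m' ∈ range (j + l + 1), (if v m = v m' then a m * a m' else 0) :=
    sum_range_sq_subset (by omega) _ (fun m m' hm => by rw [haz m hm, zero_mul, ite_self])
      (fun m m' hm' => by rw [haz m' hm', mul_zero, ite_self])
  -- the tail block on the big range
  have hB := sum_range_sq_shift j l v b
  rw [hA, ← hB, ← Finset.sum_add_distrib]
  refine Finset.sum_le_sum fun m _ => ?_
  rw [← Finset.sum_add_distrib]
  refine Finset.sum_le_sum fun m' _ => ?_
  rw [hc m, hc m']
  split_ifs <;>
    nlinarith [ha0 m, ha0 m', hb0 (m - j), hb0 (m' - j), mul_nonneg (ha0 m) (hb0 (m' - j)),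
      mul_nonneg (hb0 (m - j)) (ha0 m')]

end SplitAlgebra

/-! ### Splitting the durations at time `T`: the change of variables -/

section SplitMeasure

open Finset

variable (j l : ℕ) (T S : ℝ)

/-- The head durations `s|_{[0,j)}` of a split configuration. -/
local notation3 (prettyPrint := false) "hd[" s "]" => fun i : Fin j => (s : Fin (j + l) → ℝ) (Fin.castAdd l i)

/-- The tail durations of a split configuration (first one sheared by `Σ_{i<j} s_i - T`). -/
local notation3 (prettyPrint := false) "tl[" s "]" => fun i : Fin l =>
  (s : Fin (j + l) → ℝ) (Fin.natAdd j i) + (if (i : ℕ) = 0 then (∑ i' : Fin j, s (Fin.castAdd l i')) - T else 0)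

/-- **The split `s ↦ (hd s, tl s)` preserves Lebesgue measure** (`ℝ^{j+l} ≃ ℝ^j × ℝ^l` composed
with a shear of the first tail coordinate by a function of the head). [folklore] -/
theorem measurePreserving_split :
    MeasurePreserving (fun s : Fin (j + l) → ℝ => ((hd[s]), (tl[s])))
      (volume : Measure (Fin (j + l) → ℝ)) ((volume : Measure (Fin j → ℝ)).prod volume) := by
  -- the linear part
  let e : (Fin (j + l) → ℝ) ≃ᵐ (Fin j → ℝ) × (Fin l → ℝ) :=
    ((MeasurableEquiv.piCongrLeft (fun _ : Fin (j + l) => ℝ) finSumFinEquiv).symm).trans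
      (MeasurableEquiv.sumPiEquivProdPi fun _ : Fin j ⊕ Fin l => ℝ)
  have he : MeasurePreserving e (volume : Measure (Fin (j + l) → ℝ))
      ((volume : Measure (Fin j → ℝ)).prod volume) :=
    ((volume_measurePreserving_piCongrLeft (fun _ : Fin (j + l) => ℝ) finSumFinEquiv).symm _).trans
      (volume_measurePreserving_sumPiEquivProdPi fun _ : Fin j ⊕ Fin l => ℝ)
  -- the shear
  let w : (Fin j → ℝ) → (Fin l → ℝ) := fun a i => if (i : ℕ) = 0 then (∑ i', a i') - T else 0
  have hw : Measurable w := by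
    refine measurable_pi_lambda _ fun i => ?_
    by_cases hi : (i : ℕ) = 0
    · simp only [w, hi, if_true]
      exact (Finset.measurable_sum _ fun i' _ => measurable_pi_apply i').sub measurable_const
    · simp only [w, hi, if_false]
      exact measurable_const
  have hsh : MeasurePreserving (fun p : (Fin j → ℝ) × (Fin l → ℝ) => (p.1, p.2 + w p.1))
      ((volume : Measure (Fin j → ℝ)).prod volume) ((volume : Measure (Fin j → ℝ)).prod volume) := by
    refine (MeasurePreserving.id volume).skew_product (g := fun a b => b + w a) ?_
      (ae_of_all _ fun a => map_add_right_eq_self volume (w a))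
    exact measurable_snd.add (hw.comp measurable_fst)
  have heq : (fun s : Fin (j + l) → ℝ => ((hd[s]), (tl[s]))) =
      (fun p : (Fin j → ℝ) × (Fin l → ℝ) => (p.1, p.2 + w p.1)) ∘ e := by
    funext s
    rfl
  rw [heq]
  exact hsh.comp he

/-- Partial sums of the head coordinates: `Σ_{i<j} s_i = Σ (hd s)`. [folklore] -/
theorem sum_ite_lt_eq_sum_hd (s : Fin (j + l) → ℝ) :
    (∑ i : Fin (j + l), if (i : ℕ) < j then s i else 0) = ∑ i, (hd[s]) i := by
  rw [Fin.sum_univ_add]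
  simp only [Fin.val_castAdd, Fin.is_lt, if_true, Fin.val_natAdd, add_lt_iff_neg_left, not_lt_zero,
    if_false, Finset.sum_const_zero, add_zero]

/-- Partial sums one step further: `Σ_{i<j+1} s_i = Σ (hd s) + s_j` (`l > 0`). [folklore] -/
theorem sum_ite_lt_succ_eq (s : Fin (j + l) → ℝ) (hl : 0 < l) :
    (∑ i : Fin (j + l), if (i : ℕ) < j + 1 then s i else 0) =
      ∑ i, (hd[s]) i + s (Fin.natAdd j ⟨0, hl⟩) := by
  rw [Fin.sum_univ_add]
  congr 1
  · refine Finset.sum_congr rfl fun i _ => ?_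
    rw [if_pos (by simp only [Fin.val_castAdd]; omega)]
  · rw [Finset.sum_eq_single_of_mem (⟨0, hl⟩ : Fin l) (Finset.mem_univ _) fun i _ hi => ?_]
    · rw [if_pos (by simp)]
    · rw [if_neg]
      simp only [Fin.val_natAdd, not_lt]
      have : (i : ℕ) ≠ 0 := fun h => hi (Fin.ext h)
      omega

/-- **The configurations with exactly `j` jumps before time `T` split into admissible pieces**:
if `s ∈ Δ_{j+l}(T+S)`, `Σ_{i<j} s_i < T` and (`l > 0`) `T < Σ_{i≤j} s_i`, then
`hd s ∈ Δ_j(T)` and `tl s ∈ Δ_l(S)`. [folklore] -/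
theorem hd_mem_tl_mem {s : Fin (j + l) → ℝ} (hS : 0 < S) (hs : s ∈ sojournSet (j + l) (T + S))
    (hlt : (∑ i : Fin (j + l), if (i : ℕ) < j then s i else 0) < T)
    (hgt : 0 < l → T < ∑ i : Fin (j + l), if (i : ℕ) < j + 1 then s i else 0) :
    (hd[s]) ∈ sojournSet j T ∧ (tl[s]) ∈ sojournSet l S := by
  rw [sum_ite_lt_eq_sum_hd] at hlt
  refine ⟨⟨fun i => hs.1 _, hlt⟩, fun i => ?_, ?_⟩
  · simp only
    by_cases hi : (i : ℕ) = 0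
    · have hl : 0 < l := by have := i.isLt; omega
      rw [if_pos hi, show i = ⟨0, hl⟩ from Fin.ext hi]
      have := hgt hl
      rw [sum_ite_lt_succ_eq j l s hl] at this
      linarith
    · rw [if_neg hi, add_zero]
      exact hs.1 _
  · rw [sum_tl]
    have htot := hs.2
    rw [Fin.sum_univ_add] at htot
    split_ifs with hl
    · linarith
    · have hl0 : l = 0 := by omega
      subst hl0
      simp only [Finset.univ_eq_empty, Finset.sum_empty, add_zero]
      exact hS

/-- **The piece with `j` jumps before `T` is at most `P(T,j) P(S,l)`**: change of variables
`s ↦ (hd s, tl s)` (measure preserving, into `Δ_j(T) × Δ_l(S)`) and `e^{-gI} ≤ e^{-gI¹}e^{-gI²}`.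
[cite: BauerschmidtBrydgesSlade2015LogCorr, Appendix A (proof of Lemma A.1, (A.3))] -/
theorem lintegral_piece_le' {g : ℝ} (hg : 0 ≤ g) (hS : 0 < S) (v : ℕ → Site d) :
    ∫⁻ s in {s | s ∈ sojournSet (j + l) (T + S) ∧
        (∑ i : Fin (j + l), if (i : ℕ) < j then s i else 0) < T ∧
        (0 < l → T < ∑ i : Fin (j + l), if (i : ℕ) < j + 1 then s i else 0)},
      ENNReal.ofReal (Real.exp (-g * Isect[T + S, j + l, v, s])) ≤
    Pint[g, T, j, v] * Pint[g, S, l, (fun m => v (j + m))] := by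
  set E := {s : Fin (j + l) → ℝ | s ∈ sojournSet (j + l) (T + S) ∧
        (∑ i : Fin (j + l), if (i : ℕ) < j then s i else 0) < T ∧
        (0 < l → T < ∑ i : Fin (j + l), if (i : ℕ) < j + 1 then s i else 0)} with hE
  set Ψ := fun s : Fin (j + l) → ℝ => ((hd[s]), (tl[s])) with hΨ
  have hmp := measurePreserving_split j l T
  set G : (Fin j → ℝ) × (Fin l → ℝ) → ℝ≥0∞ := fun p =>
    ENNReal.ofReal (Real.exp (-g * Isect[T, j, v, p.1])) *
      ENNReal.ofReal (Real.exp (-g * Isect[S, l, (fun m => v (j + m)), p.2])) with hG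
  have hGm : Measurable G :=
    ((measurable_exp_isect g T j v).comp measurable_fst).mul
      ((measurable_exp_isect g S l (fun m => v (j + m))).comp measurable_snd)
  have hEsub : E ⊆ Ψ ⁻¹' (sojournSet j T ×ˢ sojournSet l S) := fun s hs =>
    Set.mem_preimage.2 (Set.mk_mem_prod (hd_mem_tl_mem j l T S hS hs.1 hs.2.1 hs.2.2).1
      (hd_mem_tl_mem j l T S hS hs.1 hs.2.1 hs.2.2).2)
  have hEm : MeasurableSet E := by
    have h1 : Measurable fun s : Fin (j + l) → ℝ => ∑ i : Fin (j + l), if (i : ℕ) < j then s i else 0 :=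
      Finset.measurable_sum _ fun i _ => by
        split_ifs
        · exact measurable_pi_apply i
        · exact measurable_const
    have h2 : Measurable fun s : Fin (j + l) → ℝ => ∑ i : Fin (j + l), if (i : ℕ) < j + 1 then s i else 0 :=
      Finset.measurable_sum _ fun i _ => by
        split_ifs
        · exact measurable_pi_apply i
        · exact measurable_const
    rw [hE, Set.setOf_and, Set.setOf_and]
    refine (measurableSet_sojournSet _ _).inter ((measurableSet_lt h1 measurable_const).inter ?_)
    by_cases hl : 0 < l
    · simp only [hl, forall_true_left]
      exact measurableSet_lt measurable_const h2
    · simp only [hl, IsEmpty.forall_iff, Set.setOf_true, MeasurableSet.univ]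
  calc ∫⁻ s in E, ENNReal.ofReal (Real.exp (-g * Isect[T + S, j + l, v, s]))
      ≤ ∫⁻ s in E, G (Ψ s) := by
        refine setLIntegral_mono' hEm fun s hs => ?_
        obtain ⟨h1, h2⟩ := hd_mem_tl_mem j l T S hS hs.1 hs.2.1 hs.2.2
        rw [hG, hΨ]
        simp only
        rw [← ENNReal.ofReal_mul (Real.exp_pos _).le, ← Real.exp_add]
        refine ENNReal.ofReal_le_ofReal (Real.exp_le_exp.2 ?_)
        have := isect_split_le j l T S v s h1 h2
        nlinarith
    _ ≤ ∫⁻ s in Ψ ⁻¹' (sojournSet j T ×ˢ sojournSet l S), G (Ψ s) := lintegral_mono_set hEsub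
    _ = ∫⁻ p in sojournSet j T ×ˢ sojournSet l S, G p ∂((volume : Measure (Fin j → ℝ)).prod volume) :=
        hmp.setLIntegral_comp_preimage ((measurableSet_sojournSet _ _).prod (measurableSet_sojournSet _ _)) hGm
    _ = Pint[g, T, j, v] * Pint[g, S, l, (fun m => v (j + m))] := by
        rw [← Measure.prod_restrict, hG]
        exact lintegral_prod_mul (measurable_exp_isect g T j v).aemeasurable
          (measurable_exp_isect g S l (fun m => v (j + m))).aemeasurable

end SplitMeasure

/-! ### The pieces cover the simplex up to a null set -/

section Cover

open Finset

/-- The hyperplanes `{Σ_{i<m} s_i = T}` (`1 ≤ m ≤ k`) are Lebesgue-null in `ℝ^k`. [folklore] -/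
theorem volume_partialSum_eq {k m : ℕ} (hm : 1 ≤ m) (hmk : m ≤ k) (T : ℝ) :
    volume {s : Fin k → ℝ | (∑ i : Fin k, if (i : ℕ) < m then s i else 0) = T} = 0 := by
  obtain ⟨k, rfl⟩ : ∃ k', k = k' + 1 := ⟨k - 1, by omega⟩
  set A := {s : Fin (k + 1) → ℝ | (∑ i : Fin (k + 1), if (i : ℕ) < m then s i else 0) = T} with hA
  set e := MeasurableEquiv.piFinSuccAbove (fun _ : Fin (k + 1) => ℝ) 0 with he
  have hmp : MeasurePreserving e.symm (volume : Measure (ℝ × (Fin k → ℝ))) volume :=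
    (volume_preserving_piFinSuccAbove (fun _ : Fin (k + 1) => ℝ) 0).symm
  have hsymm : ∀ p : ℝ × (Fin k → ℝ), e.symm p = Fin.cons p.1 p.2 := fun p =>
    Fin.insertNth_zero' p.1 p.2
  -- the section function of the remaining coordinates
  set c : (Fin k → ℝ) → ℝ := fun y => ∑ i : Fin k, if (i : ℕ) + 1 < m then y i else 0 with hc
  have hcm : Measurable c := Finset.measurable_sum _ fun i _ => by
    split_ifs
    · exact measurable_pi_apply i
    · exact measurable_const
  have hpre : e.symm ⁻¹' A = {p : ℝ × (Fin k → ℝ) | p.1 + c p.2 = T} := by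
    ext p
    simp only [Set.mem_preimage, hA, Set.mem_setOf_eq, hsymm, Fin.sum_univ_succ, Fin.val_zero,
      Fin.cons_zero, Fin.val_succ, Fin.cons_succ, hc]
    rw [if_pos (by omega)]
  have hB : MeasurableSet {p : ℝ × (Fin k → ℝ) | p.1 + c p.2 = T} :=
    measurableSet_eq_fun (measurable_fst.add (hcm.comp measurable_snd)) measurable_const
  rw [← hmp.measure_preimage_equiv A, hpre, Measure.volume_eq_prod, Measure.prod_apply_symm hB]
  have hfib : ∀ y : Fin k → ℝ, (fun x : ℝ => (x, y)) ⁻¹' {p : ℝ × (Fin k → ℝ) | p.1 + c p.2 = T} =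
      {T - c y} := fun y => by
    ext x
    simp only [Set.mem_preimage, Set.mem_setOf_eq, Set.mem_singleton_iff]
    constructor <;> intro h <;> linarith
  simp_rw [hfib, Real.volume_singleton, lintegral_zero]

/-- **The pieces cover the simplex**: up to the null set of configurations with a jump exactly at
time `T`, every `s ∈ Δ_k(T+S)` has a well-defined number `j ≤ k` of jumps before `T`
(`Σ_{i<j} s_i < T < Σ_{i≤j} s_i`), so `∫_{Δ_k(T+S)} e^{-gI} ≤ Σ_{j≤k} ∫_{piece j} e^{-gI}`.
[cite: BauerschmidtBrydgesSlade2015LogCorr, Appendix A (proof of Lemma A.1, (A.3))] -/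
theorem pint_le_sum_pieces (g : ℝ) {T : ℝ} (hT : 0 < T) (S : ℝ) (k : ℕ) (v : ℕ → Site d) :
    Pint[g, T + S, k, v] ≤ ∑ j ∈ range (k + 1),
      ∫⁻ s in {s | s ∈ sojournSet k (T + S) ∧ (∑ i : Fin k, if (i : ℕ) < j then s i else 0) < T ∧
          (j < k → T < ∑ i : Fin k, if (i : ℕ) < j + 1 then s i else 0)},
        ENNReal.ofReal (Real.exp (-g * Isect[T + S, k, v, s])) := by
  set F := fun s : Fin k → ℝ => ENNReal.ofReal (Real.exp (-g * Isect[T + S, k, v, s])) with hF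
  set PS := fun (m : ℕ) (s : Fin k → ℝ) => ∑ i : Fin k, if (i : ℕ) < m then s i else 0 with hPS
  set E := fun j : ℕ => {s | s ∈ sojournSet k (T + S) ∧ PS j s < T ∧ (j < k → T < PS (j + 1) s)}
    with hE
  set N := ⋃ m ∈ Finset.Icc 1 k, {s : Fin k → ℝ | PS m s = T} with hN
  have hN0 : volume N = 0 :=
    (measure_biUnion_null_iff (Finset.countable_toSet _)).2 fun m hm => by
      rw [Finset.mem_coe, Finset.mem_Icc] at hm
      exact volume_partialSum_eq hm.1 hm.2 T
  have hcover : sojournSet k (T + S) \ N ⊆ ⋃ j : Fin (k + 1), E j := by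
    rintro s ⟨hsΔ, hsN⟩
    have hP0 : PS 0 s < T := by simpa [hPS] using hT
    set j := Nat.findGreatest (fun m => PS m s < T) k with hj
    have hjk : j ≤ k := Nat.findGreatest_le k
    have hjP : PS j s < T := Nat.findGreatest_spec (P := fun m => PS m s < T) (Nat.zero_le k) hP0
    refine Set.mem_iUnion.2 ⟨⟨j, Nat.lt_succ_of_le hjk⟩, hsΔ, hjP, fun hlt => ?_⟩
    change j < k at hlt
    have hnot : ¬PS (j + 1) s < T :=
      Nat.findGreatest_is_greatest (P := fun m => PS m s < T) (Nat.lt_succ_self j) (by omega)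
    have hne : PS (j + 1) s ≠ T := fun h =>
      hsN (Set.mem_iUnion₂.2 ⟨j + 1, by simp only [Finset.mem_Icc]; omega, h⟩)
    exact lt_of_le_of_ne (not_lt.1 hnot) (Ne.symm hne)
  calc Pint[g, T + S, k, v] = ∫⁻ s in sojournSet k (T + S) \ N, F s :=
        (setLIntegral_congr (sdiff_null_ae_eq_self hN0)).symm
    _ ≤ ∫⁻ s in ⋃ j : Fin (k + 1), E j, F s := lintegral_mono_set hcover
    _ ≤ ∑' j : Fin (k + 1), ∫⁻ s in E j, F s := lintegral_iUnion_le _ _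
    _ = ∑ j : Fin (k + 1), ∫⁻ s in E j, F s := tsum_fintype _
    _ = ∑ j ∈ range (k + 1), ∫⁻ s in E j, F s :=
        Fin.sum_univ_eq_sum_range (fun j => ∫⁻ s in E j, F s) (k + 1)

end Cover

/-! ### Sub-multiplicativity -/

section Submult

open Finset
open scoped Classical

/-- **Sub-multiplicativity `c_{T+S} ≤ c_T c_S`** (`T, S > 0`, `g ≥ 0`) for the continuous-time weakly
self-avoiding walk in the jump-chain representation.
[cite: BauerschmidtBrydgesSlade2015LogCorr, Appendix A (proof of Lemma A.1, (A.3))] -/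
theorem survival_add_le {g : ℝ} (hg : 0 ≤ g) (d : ℕ) {T S : ℝ} (hT : 0 < T) (hS : 0 < S) :
    survival d g (T + S) ≤ survival d g T * survival d g S := by
  rw [survival_eq_tsum_sum_fun d g (T + S), survival_eq_tsum_sum_fun d g T,
    survival_eq_tsum_sum_fun d g S, mul_mul_mul_comm, ← ENNReal.ofReal_mul (Real.exp_pos _).le,
    ← Real.exp_add, show -(2 * (d : ℝ)) * T + -(2 * d) * S = -(2 * d) * (T + S) by ring]
  refine mul_le_mul' le_rfl ?_
  rw [Literature.Probability.RandomPlanarGeometry.SAW.Zd.ennreal_tsum_mul_tsum_eq_tsum_sum_antidiagonal]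
  refine ENNReal.tsum_le_tsum fun k => ?_
  have hf : ∀ (n : ℕ) (U : ℝ) (v w : ℕ → Site d), (∀ m ≤ n, v m = w m) →
      Pint[g, U, n, v] = Pint[g, U, n, w] :=
    fun n U v w h => pint_congr (v := v) (w := w) g U fun m hm m' hm' => by rw [h m hm, h m' hm']
  calc ∑ v ∈ AF[d, k], Pint[g, T + S, k, v]
      ≤ ∑ v ∈ AF[d, k], ∑ j ∈ range (k + 1),
          ∫⁻ s in {s | s ∈ sojournSet k (T + S) ∧ (∑ i : Fin k, if (i : ℕ) < j then s i else 0) < T ∧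
              (j < k → T < ∑ i : Fin k, if (i : ℕ) < j + 1 then s i else 0)},
            ENNReal.ofReal (Real.exp (-g * Isect[T + S, k, v, s])) :=
        Finset.sum_le_sum fun v _ => pint_le_sum_pieces g hT S k v
    _ = ∑ v ∈ AF[d, k], ∑ jl ∈ antidiagonal k,
          ∫⁻ s in {s | s ∈ sojournSet k (T + S) ∧ (∑ i : Fin k, if (i : ℕ) < jl.1 then s i else 0) < T ∧
              (jl.1 < k → T < ∑ i : Fin k, if (i : ℕ) < jl.1 + 1 then s i else 0)},
            ENNReal.ofReal (Real.exp (-g * Isect[T + S, k, v, s])) := by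
        refine Finset.sum_congr rfl fun v _ => ?_
        rw [Finset.Nat.sum_antidiagonal_eq_sum_range_succ_mk]
    _ ≤ ∑ v ∈ AF[d, k], ∑ jl ∈ antidiagonal k,
          Pint[g, T, jl.1, v] * Pint[g, S, jl.2, (fun m => v (jl.1 + m))] := by
        refine Finset.sum_le_sum fun v _ => Finset.sum_le_sum fun jl hjl => ?_
        obtain ⟨j, l⟩ := jl
        have hk : j + l = k := Finset.mem_antidiagonal.1 hjl
        subst hk
        simp only
        have hlk : ∀ s : Fin (j + l) → ℝ,
            (j < j + l → T < ∑ i : Fin (j + l), if (i : ℕ) < j + 1 then s i else 0) ↔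
            (0 < l → T < ∑ i : Fin (j + l), if (i : ℕ) < j + 1 then s i else 0) := fun s => by
          constructor
          · intro h hl; exact h (by omega)
          · intro h hl; exact h (by omega)
        simp_rw [hlk]
        exact lintegral_piece_le' j l T S hg hS v
    _ = ∑ jl ∈ antidiagonal k, ∑ v ∈ AF[d, jl.1 + jl.2],
          Pint[g, T, jl.1, v] * Pint[g, S, jl.2, (fun m => v (jl.1 + m))] := by
        rw [Finset.sum_comm]
        refine Finset.sum_congr rfl fun jl hjl => ?_
        rw [(Finset.mem_antidiagonal.1 hjl : jl.1 + jl.2 = k)]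
    _ = ∑ jl ∈ antidiagonal k, (∑ v ∈ AF[d, jl.1], Pint[g, T, jl.1, v]) *
          ∑ v ∈ AF[d, jl.2], Pint[g, S, jl.2, v] := by
        refine Finset.sum_congr rfl fun jl _ => ?_
        rw [← sum_fun_split jl.1 jl.2 (fun v => Pint[g, T, jl.1, v]) (fun v => Pint[g, S, jl.2, v])
          (hf jl.1 T)]
        refine Finset.sum_congr rfl fun v _ => ?_
        congr 1
        exact (pint_congr (v := fun m => v (jl.1 + m) - v jl.1) (w := fun m => v (jl.1 + m)) g S
          fun _ _ _ _ => sub_left_inj).symm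

/-! ### Consequences: geometric bounds and the critical value -/

/-- Iterating: `c_{(n+1)T₀} ≤ c_{T₀}^{n+1}`. [cite: BauerschmidtBrydgesSlade2015LogCorr, Appendix A (proof of Lemma A.1)] -/
theorem survival_succ_mul_le {g : ℝ} (hg : 0 ≤ g) (d : ℕ) {T₀ : ℝ} (hT₀ : 0 < T₀) :
    ∀ n : ℕ, survival d g ((n + 1) * T₀) ≤ survival d g T₀ ^ (n + 1)
  | 0 => by simp
  | n + 1 => by
    rw [show ((n + 1 : ℕ) + 1 : ℝ) * T₀ = (n + 1) * T₀ + T₀ by push_cast; ring, pow_succ]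
    exact (survival_add_le hg d (by positivity) hT₀).trans
      (mul_le_mul' (by exact_mod_cast survival_succ_mul_le hg d hT₀ n) le_rfl)

/-- **`c_T ≤ c_{T₀}ⁿ` whenever `nT₀ < T`** (`g ≥ 0`). [cite: BauerschmidtBrydgesSlade2015LogCorr, Appendix A (proof of Lemma A.1)] -/
theorem survival_le_pow {g : ℝ} (hg : 0 ≤ g) (d : ℕ) {T₀ T : ℝ} (hT₀ : 0 < T₀) {n : ℕ}
    (h : n * T₀ < T) : survival d g T ≤ survival d g T₀ ^ n := by
  rcases n with _ | n
  · rw [pow_zero]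
    exact survival_le_one hg d (by simpa using h)
  · have hsplit : T = (n + 1) * T₀ + (T - (n + 1) * T₀) := by ring
    have hrest : 0 < T - (n + 1) * T₀ := by push_cast at h; linarith
    rw [hsplit]
    calc survival d g ((n + 1) * T₀ + (T - (n + 1) * T₀))
        ≤ survival d g ((n + 1) * T₀) * survival d g (T - (n + 1) * T₀) :=
          survival_add_le hg d (by positivity) hrest
      _ ≤ survival d g T₀ ^ (n + 1) * 1 :=
          mul_le_mul' (survival_succ_mul_le hg d hT₀ n) (survival_le_one hg d hrest)
      _ = survival d g T₀ ^ (n + 1) := mul_one _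

/-- **`χ(g,ν) < ∞` as soon as `c_{T₀} e^{-νT₀} < 1` for some `T₀ > 0`** (geometric comparison on the
time blocks `(nT₀, (n+1)T₀]`). [cite: BauerschmidtBrydgesSlade2015LogCorr, Appendix A (proof of Lemma A.1)] -/
theorem susceptibility_lt_top_of_ratio_lt_one {g : ℝ} (hg : 0 ≤ g) (d : ℕ) {T₀ ν : ℝ} (hT₀ : 0 < T₀)
    (hr : survival d g T₀ * ENNReal.ofReal (Real.exp (-ν * T₀)) < 1) :
    susceptibility d g ν < ∞ := by
  set r := survival d g T₀ * ENNReal.ofReal (Real.exp (-ν * T₀)) with hrdef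
  set K := ENNReal.ofReal (max 1 (Real.exp (-ν * T₀))) with hK
  set f := fun T : ℝ => survival d g T * ENNReal.ofReal (Real.exp (-ν * T)) with hfdef
  -- the time blocks
  have hcover : Ioi (0 : ℝ) ⊆ ⋃ n : ℕ, Ioc ((n : ℝ) * T₀) ((n + 1) * T₀) := by
    intro T hT
    rw [Set.mem_Ioi] at hT
    have hc : 0 < ⌈T / T₀⌉₊ := Nat.ceil_pos.2 (div_pos hT hT₀)
    refine Set.mem_iUnion.2 ⟨⌈T / T₀⌉₊ - 1, ?_, ?_⟩
    · have h1 : ((⌈T / T₀⌉₊ - 1 : ℕ) : ℝ) < T / T₀ := Nat.lt_ceil.1 (by omega)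
      rwa [lt_div_iff₀ hT₀] at h1
    · have h2 : T / T₀ ≤ ⌈T / T₀⌉₊ := Nat.le_ceil _
      rw [div_le_iff₀ hT₀] at h2
      have h3 : ((⌈T / T₀⌉₊ - 1 : ℕ) : ℝ) + 1 = ⌈T / T₀⌉₊ := by
        rw [Nat.cast_sub (by omega)]; push_cast; ring
      rw [h3]; exact h2
  -- the pointwise bound on one block
  have hpt : ∀ (n : ℕ), ∀ T ∈ Ioc ((n : ℝ) * T₀) ((n + 1) * T₀), f T ≤ K * r ^ n := by
    intro n T hT
    have hexp : Real.exp (-ν * T) ≤ max 1 (Real.exp (-ν * T₀)) * Real.exp (-ν * T₀) ^ n := by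
      rw [← Real.exp_nat_mul]
      have hmax1 : (1 : ℝ) ≤ max 1 (Real.exp (-ν * T₀)) := le_max_left _ _
      have hmax2 : Real.exp (-ν * T₀) ≤ max 1 (Real.exp (-ν * T₀)) := le_max_right _ _
      have hpos : 0 < Real.exp (n * (-ν * T₀)) := Real.exp_pos _
      rcases le_or_gt 0 ν with hν | hν
      · have h1 : Real.exp (-ν * T) ≤ Real.exp (n * (-ν * T₀)) :=
          Real.exp_le_exp.2 (by nlinarith [hT.1])
        nlinarith [mul_le_mul_of_nonneg_right hmax1 hpos.le]
      · have h1 : Real.exp (-ν * T) ≤ Real.exp (-ν * T₀) * Real.exp (n * (-ν * T₀)) := by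
          rw [← Real.exp_add]
          exact Real.exp_le_exp.2 (by nlinarith [hT.2])
        nlinarith [mul_le_mul_of_nonneg_right hmax2 hpos.le]
    calc f T = survival d g T * ENNReal.ofReal (Real.exp (-ν * T)) := rfl
      _ ≤ survival d g T₀ ^ n * ENNReal.ofReal (max 1 (Real.exp (-ν * T₀)) * Real.exp (-ν * T₀) ^ n) :=
          mul_le_mul' (survival_le_pow hg d hT₀ hT.1) (ENNReal.ofReal_le_ofReal hexp)
      _ = K * r ^ n := by
          rw [hK, hrdef, ENNReal.ofReal_mul (le_trans zero_le_one (le_max_left _ _)),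
            ENNReal.ofReal_pow (Real.exp_pos _).le, mul_pow]
          ring
  have hblock : ∀ n : ℕ, ∫⁻ T in Ioc ((n : ℝ) * T₀) ((n + 1) * T₀), f T ≤
      K * ENNReal.ofReal T₀ * r ^ n := fun n =>
    calc ∫⁻ T in Ioc ((n : ℝ) * T₀) ((n + 1) * T₀), f T
        ≤ ∫⁻ _ in Ioc ((n : ℝ) * T₀) ((n + 1) * T₀), K * r ^ n := setLIntegral_mono' measurableSet_Ioc (hpt n)
      _ = K * r ^ n * volume (Ioc ((n : ℝ) * T₀) ((n + 1) * T₀)) := setLIntegral_const _ _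
      _ = K * ENNReal.ofReal T₀ * r ^ n := by
          rw [Real.volume_Ioc, show ((n : ℝ) + 1) * T₀ - n * T₀ = T₀ by ring]; ring
  -- summing the geometric series
  calc susceptibility d g ν = ∫⁻ T in Ioi 0, f T := rfl
    _ ≤ ∫⁻ T in ⋃ n : ℕ, Ioc ((n : ℝ) * T₀) ((n + 1) * T₀), f T := lintegral_mono_set hcover
    _ ≤ ∑' n : ℕ, ∫⁻ T in Ioc ((n : ℝ) * T₀) ((n + 1) * T₀), f T := lintegral_iUnion_le _ _
    _ ≤ ∑' n : ℕ, K * ENNReal.ofReal T₀ * r ^ n := ENNReal.tsum_le_tsum hblock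
    _ = K * ENNReal.ofReal T₀ * (1 - r)⁻¹ := by rw [ENNReal.tsum_mul_left, ENNReal.tsum_geometric]
    _ < ∞ := by
        refine ENNReal.mul_lt_top (ENNReal.mul_lt_top ENNReal.ofReal_lt_top ENNReal.ofReal_lt_top) ?_
        exact ENNReal.inv_lt_top.2 (tsub_pos_iff_lt.2 hr)

/-- If `χ(g,ν) < ∞` then `c_{T₀} e^{-νT₀} < 1` for some `T₀ > 0` (otherwise `c_T e^{-νT} ≥ 1` for
all `T` and the defining integral diverges). [cite: BauerschmidtBrydgesSlade2015LogCorr, Appendix A (proof of Lemma A.1: c_T ≥ e^{ν_c T})] -/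
theorem exists_ratio_lt_one_of_susceptibility_lt_top (d : ℕ) {g ν : ℝ}
    (h : susceptibility d g ν < ∞) :
    ∃ T₀ : ℝ, 0 < T₀ ∧ survival d g T₀ * ENNReal.ofReal (Real.exp (-ν * T₀)) < 1 := by
  by_contra hcon
  push Not at hcon
  have : susceptibility d g ν = ∞ := by
    refine eq_top_iff.2 ?_
    calc (⊤ : ℝ≥0∞) = ∫⁻ _ in Ioi (0 : ℝ), 1 := by rw [setLIntegral_one, Real.volume_Ioi]
      _ ≤ susceptibility d g ν := setLIntegral_mono' measurableSet_Ioi fun T hT => hcon T hT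
  exact h.ne this

/-- **`{ν | χ(g,ν) < ∞}` is open to the left**: if `χ(g,ν) < ∞` then `χ(g,ν') < ∞` for some
`ν' < ν` (`g ≥ 0`). [cite: BauerschmidtBrydgesSlade2015LogCorr, Lemma A.1] -/
theorem exists_lt_susceptibility_lt_top {g : ℝ} (hg : 0 ≤ g) (d : ℕ) {ν : ℝ}
    (h : susceptibility d g ν < ∞) : ∃ ν' < ν, susceptibility d g ν' < ∞ := by
  obtain ⟨T₀, hT₀, hr⟩ := exists_ratio_lt_one_of_susceptibility_lt_top d h
  have hc : survival d g T₀ ≠ ∞ := (lt_of_le_of_lt (survival_le_one hg d hT₀) ENNReal.one_lt_top).ne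
  set c := (survival d g T₀).toReal with hcdef
  have hceq : survival d g T₀ = ENNReal.ofReal c := (ENNReal.ofReal_toReal hc).symm
  have hc0 : 0 ≤ c := ENNReal.toReal_nonneg
  have hreal : ∀ ν' : ℝ, survival d g T₀ * ENNReal.ofReal (Real.exp (-ν' * T₀)) =
      ENNReal.ofReal (c * Real.exp (-ν' * T₀)) := fun ν' => by
    rw [hceq, ENNReal.ofReal_mul hc0]
  have hr' : c * Real.exp (-ν * T₀) < 1 := by
    have := hr
    rw [hreal, ← ENNReal.ofReal_one, ENNReal.ofReal_lt_ofReal_iff one_pos] at this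
    exact this
  have hcont : Continuous fun ν' : ℝ => c * Real.exp (-ν' * T₀) := by fun_prop
  have hev : ∀ᶠ ν' in nhds ν, c * Real.exp (-ν' * T₀) < 1 :=
    hcont.continuousAt.eventually_lt continuousAt_const hr'
  have hev' : ∀ᶠ ν' in nhdsWithin ν (Iio ν), c * Real.exp (-ν' * T₀) < 1 ∧ ν' ∈ Iio ν :=
    (hev.filter_mono nhdsWithin_le_nhds).and self_mem_nhdsWithin
  obtain ⟨ν', hν'1, hν'2⟩ := hev'.exists
  refine ⟨ν', hν'2, susceptibility_lt_top_of_ratio_lt_one hg d hT₀ ?_⟩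
  rw [hreal, ← ENNReal.ofReal_one, ENNReal.ofReal_lt_ofReal_iff one_pos]
  exact hν'1

/-- **Lemma A.1, main clause: `χ(g,ν) < ∞ ↔ ν > ν_c`** (`d ≥ 1`, `g ≥ 0`).
[cite: BauerschmidtBrydgesSlade2015LogCorr, Lemma A.1] -/
theorem susceptibility_lt_top_iff (hd : 0 < d) {g : ℝ} (hg : 0 ≤ g) (ν : ℝ) :
    susceptibility d g ν < ∞ ↔ criticalNu d g < ν := by
  refine ⟨fun h => ?_, susceptibility_lt_top_of_criticalNu_lt hg⟩
  obtain ⟨ν', hν', hν's⟩ := exists_lt_susceptibility_lt_top hg d h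
  exact lt_of_le_of_lt (csInf_le (bddBelow_susceptibility_lt_top hd hg) hν's) hν'

/-- **`χ(g, ν_c) = ∞`**: the susceptibility diverges at the critical value (`d ≥ 1`, `g ≥ 0`).
[cite: BauerschmidtBrydgesSlade2015LogCorr, Lemma A.1] -/
theorem susceptibility_criticalNu_eq_top (hd : 0 < d) {g : ℝ} (hg : 0 ≤ g) :
    susceptibility d g (criticalNu d g) = ∞ := by
  by_contra h
  exact lt_irrefl _ ((susceptibility_lt_top_iff hd hg _).1 (lt_top_iff_ne_top.2 h))

end Submult

end Literature.Barriers.CriticalPhenomena.CTWSAW
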